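import Literature.Computability.QuantumComplexity.ForrelationDerivativeTables
import Summits.QuantumAdvantage.QuantumAdvantage.Theorems.CubicForrelationNearExactIsExactFibreAverageRelabeled

/-!
# `NearExactIsExact` (stmt-QuantumAdvantage-14043), negative side — the PARTNER-FREE `L¹` bound for relabeled fibre families

B2b disprover cell, generation 30 (`b2b-cforr-disprove-g30`).  HONEST FRAMING: a kernel-checked STRUCTURE LEMMA (finite-sum
inequality, [folklore]) that makes the "A-level" census verdicts of the seat's `DISPROOF.md` §38 rigorous against EVERY partner;
it is NOT summit progress and produces no value above the `n = 14` record `57/64`.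

**Setting.** A RELABELED FIBRE FAMILY (`…Theorems.CubicForrelation.NearExactIsExact.stub_fibreAverageRelabeled`) is a Boolean
`g` on `s + s + k` bits in the sign form `(-1)^{g(y′ ‖ u ‖ w)} = (-1)^{y′·π(u)} (-1)^{G_u(w)}` with `π` a permutation of `𝔽₂^s`
(two-sided inverse `σ`; no degree hypotheses) and arbitrary slices `G_u : 𝔽₂^k → 𝔽₂`.  The landed stub says that against a
partner of the MATCHING shape `f(a ‖ b ‖ c) = b·σ(a) ⊕ F_a(c)` one has `Φ(f,g) = 2^{-s} Σ_a Φ(F_a, G_{σ(a)})`.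

**This file: arbitrary partners.** For EVERY Boolean `f` on `s + s + k` bits (no shape, no degree hypothesis)

  `Σ_{x,y} (-1)^{f(x)} (-1)^{x·y} (-1)^{g(y)} ≤ 2^s · 2^s · Σ_u Σ_c |W_{G_u}(c)|`            (`far_fsum_le_l1`),
  `Φ(f,g) ≤ 2^{-s} Σ_u ‖W_{G_u}‖₁ / 2^{3k/2}`                                                  (`forrelation_le_fibreL1`),

where `W_{G_u}(c) = Σ_w (-1)^{G_u(w)} (-1)^{w·c}` is the Walsh transform of the slice (`DerivativeWalsh.W`) and
`‖W_{G_u}‖₁ = Σ_c |W_{G_u}(c)|` its `L¹` mass ("A(G_u)" in the seat's census).  Proof: the dual sum over the linear block pins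
the fibre, `Σ_y (-1)^{x·y}(-1)^{g(y)} = 2^s (-1)^{b·σ(a)} W_{G_{σ(a)}}(c)` for `x = a ‖ b ‖ c` (`far_inner_sum`, landed); bound each
term by its absolute value, sum the `2^s` values of `b`, and re-index `a ↦ σ(a)`.  With a per-slice budget
(`forrelation_le_of_sliceMass_le`): if `‖W_{G_u}‖₁ ≤ B_u` for all `u` then `Φ(f,g) ≤ 2^{-s} Σ_u B_u / 2^{3k/2}`.

**Why it matters.** A bent slice has `‖W‖₁ = 2^{3k/2}` (full mass), a non-bent slice ("apex") strictly less — e.g. at `k = 6`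
every non-bent cubic has `‖W‖₁ ≤ 440 < 512`, a non-bent cubic with a bent-supporting cubic part `≤ 384`, a non-bent quadratic
`≤ 256` (seat census, gen 2 / gen 30).  Hence for the twisted two-sided habitats `H(s, k; 2s+k)` of `DISPROOF.md` §38 the
"A-dead" verdicts (`j` apexes whose total mass cannot reach the record threshold) hold against ALL partners `f` of any degree,
not only against shaped ones; only the finer dual-compatibility level of the census uses the partner's shape.  Complements
`Negative.ProjectionConcat.pc_forrelation_le` (all slices bent, cubic partner, distance of the dual table to cubics) and the
equality `stub_fibreAverageRelabeled` (shaped partner).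

References: S. Aaronson, A. Ambainis, Forrelation, SIAM J. Comput. 47 (2018) §1.1.1 (definition of `Φ`); J. F. Dillon,
Elementary Hadamard difference sets (1974) Ch. 5 and C. Carlet, Boolean Functions for Cryptography and Coding Theory (2021)
§6.1.15 (Maiorana–McFarland fibrations, Walsh transform fibre by fibre).  Everything below is proved; standard axioms only.
-/

set_option linter.dupNamespace false -- D-0017: single-problem summit ⇒ `QuantumAdvantage.QuantumAdvantage` by design

namespace Summit.QuantumAdvantage.QuantumAdvantage.Theorems.NearExactIsExact.Negative.FibreL1Bound

open Finset
open Literature.Computability.QuantumComplexity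
open Literature.Computability.QuantumComplexity.DerivativeWalsh (W)
open Summit.QuantumAdvantage.QuantumAdvantage.Theorems.CubicForrelation.NearExactIsExact
  (far_inner_sum mw_sqrt_two_pow)

/-- The slice sum produced by `far_inner_sum` is the slice's Walsh coefficient scaled by the constant:
`Σ_w C (-1)^{c·w} (-1)^{G(w)} = C · W_G(c)`. [folklore] -/
theorem sum_const_twist_signOf {k : ℕ} (C : ℝ) (Gu : (Fin k → Bool) → Bool) (c : Fin k → Bool) :
    ∑ w : Fin k → Bool, C * twist c w * signOf (Gu w) = C * W (fun w => signOf (Gu w)) c := by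
  unfold W
  rw [mul_sum]
  refine sum_congr rfl fun w _ => ?_
  rw [twist_comm c w]
  ring

/-- **Partner-free `L¹` bound for a relabeled fibre family (unnormalised).** If
`(-1)^{g(y′ ‖ u ‖ w)} = (-1)^{y′·π(u)} (-1)^{G_u(w)}` with `σ = π⁻¹` (two-sided), then for EVERY Boolean `f` on `s + s + k` bits
`Σ_{x,y} (-1)^{f(x)} (-1)^{x·y} (-1)^{g(y)} ≤ 2^s · 2^s · Σ_u Σ_c |W_{G_u}(c)|`. [folklore] -/
theorem far_fsum_le_l1 {s k : ℕ} (f g : (Fin (s + s + k) → Bool) → Bool)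
    (G : (Fin s → Bool) → (Fin k → Bool) → Bool) (π σ : (Fin s → Bool) → (Fin s → Bool))
    (hσπ : ∀ u, σ (π u) = u) (hπσ : ∀ a, π (σ a) = a)
    (hg : ∀ (y u : Fin s → Bool) (w : Fin k → Bool),
      signOf (g (Fin.append (Fin.append y u) w)) = twist y (π u) * signOf (G u w)) :
    ∑ x : Fin (s + s + k) → Bool, ∑ y : Fin (s + s + k) → Bool, signOf (f x) * twist x y * signOf (g y) ≤
      (2 : ℝ) ^ s * (2 : ℝ) ^ s *
        ∑ u : Fin s → Bool, ∑ c : Fin k → Bool, |W (fun w => signOf (G u w)) c| := by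
  rw [sum_append (n₁ := s + s) (n₂ := k), sum_append (n₁ := s) (n₂ := s)]
  have e : ∀ (a b : Fin s → Bool) (c : Fin k → Bool),
      ∑ y : Fin (s + s + k) → Bool, signOf (f (Fin.append (Fin.append a b) c)) *
          twist (Fin.append (Fin.append a b) c) y * signOf (g y) =
        (2 : ℝ) ^ s * twist b (σ a) *
          (signOf (f (Fin.append (Fin.append a b) c)) * W (fun w => signOf (G (σ a) w)) c) := by
    intro a b c
    rw [far_inner_sum g G π σ hσπ hπσ hg, sum_const_twist_signOf]
  simp_rw [e]
  -- termwise absolute-value bound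
  have hterm : ∀ (a b : Fin s → Bool) (c : Fin k → Bool),
      (2 : ℝ) ^ s * twist b (σ a) *
          (signOf (f (Fin.append (Fin.append a b) c)) * W (fun w => signOf (G (σ a) w)) c) ≤
        (2 : ℝ) ^ s * |W (fun w => signOf (G (σ a) w)) c| := by
    intro a b c
    refine (le_abs_self _).trans (le_of_eq ?_)
    rw [abs_mul, abs_mul, abs_mul, abs_twist, abs_signOf, abs_of_pos (by positivity : (0 : ℝ) < 2 ^ s)]
    ring
  have hsum : ∀ a : Fin s → Bool,
      ∑ b : Fin s → Bool, ∑ c : Fin k → Bool, (2 : ℝ) ^ s * twist b (σ a) *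
          (signOf (f (Fin.append (Fin.append a b) c)) * W (fun w => signOf (G (σ a) w)) c) ≤
        (2 : ℝ) ^ s * ((2 : ℝ) ^ s * ∑ c : Fin k → Bool, |W (fun w => signOf (G (σ a) w)) c|) := by
    intro a
    calc ∑ b : Fin s → Bool, ∑ c : Fin k → Bool, (2 : ℝ) ^ s * twist b (σ a) *
            (signOf (f (Fin.append (Fin.append a b) c)) * W (fun w => signOf (G (σ a) w)) c)
        ≤ ∑ _b : Fin s → Bool, ∑ c : Fin k → Bool, (2 : ℝ) ^ s * |W (fun w => signOf (G (σ a) w)) c| :=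
          sum_le_sum fun b _ => sum_le_sum fun c _ => hterm a b c
      _ = (2 : ℝ) ^ s * ((2 : ℝ) ^ s * ∑ c : Fin k → Bool, |W (fun w => signOf (G (σ a) w)) c|) := by
          rw [sum_const, card_univ, Fintype.card_fun, Fintype.card_bool, Fintype.card_fin, nsmul_eq_mul, ← mul_sum]
          push_cast
          ring
  refine (sum_le_sum fun a _ => hsum a).trans (le_of_eq ?_)
  rw [← mul_sum, ← mul_sum, ← mul_assoc]
  congr 1
  let eσ : (Fin s → Bool) ≃ (Fin s → Bool) := ⟨σ, π, hπσ, hσπ⟩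
  exact eσ.sum_comp (fun u => ∑ c : Fin k → Bool, |W (fun w => signOf (G u w)) c|)

/-- **Partner-free `L¹` MASTER BOUND for a relabeled fibre family.** Under the sign form
`(-1)^{g(y′ ‖ u ‖ w)} = (-1)^{y′·π(u)} (-1)^{G_u(w)}` (`σ = π⁻¹` two-sided), for EVERY Boolean `f` on `s + s + k` bits
`Φ(f,g) ≤ 2^{-s} Σ_u ‖W_{G_u}‖₁ / √(2^{3k})`: the forrelation against ANY partner is at most the fibre average of the slices'
normalised `L¹` Walsh masses (a bent slice has normalised mass `1`). [folklore] -/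
theorem forrelation_le_fibreL1 {s k : ℕ} (f g : (Fin (s + s + k) → Bool) → Bool)
    (G : (Fin s → Bool) → (Fin k → Bool) → Bool) (π σ : (Fin s → Bool) → (Fin s → Bool))
    (hσπ : ∀ u, σ (π u) = u) (hπσ : ∀ a, π (σ a) = a)
    (hg : ∀ (y u : Fin s → Bool) (w : Fin k → Bool),
      signOf (g (Fin.append (Fin.append y u) w)) = twist y (π u) * signOf (G u w)) :
    forrelation f g ≤ ((2 : ℝ) ^ s)⁻¹ * ∑ u : Fin s → Bool,
      (Real.sqrt ((2 : ℝ) ^ (3 * k)))⁻¹ * ∑ c : Fin k → Bool, |W (fun w => signOf (G u w)) c| := by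
  have hS := far_fsum_le_l1 f g G π σ hσπ hπσ hg
  unfold forrelation
  rw [sqrt_two_pow_three_mul_add (s + s) k, mw_sqrt_two_pow s, ← mul_sum]
  have h2 : (0 : ℝ) < (2 : ℝ) ^ s := by positivity
  have hR : (0 : ℝ) < Real.sqrt ((2 : ℝ) ^ (3 * k)) := by positivity
  have hpos : (0 : ℝ) < ((2 : ℝ) ^ s * (2 : ℝ) ^ (2 * s) * Real.sqrt ((2 : ℝ) ^ (3 * k)))⁻¹ := by positivity
  calc ((2 : ℝ) ^ s * (2 : ℝ) ^ (2 * s) * Real.sqrt ((2 : ℝ) ^ (3 * k)))⁻¹ *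
          ∑ x : Fin (s + s + k) → Bool, ∑ y : Fin (s + s + k) → Bool, signOf (f x) * twist x y * signOf (g y)
      ≤ ((2 : ℝ) ^ s * (2 : ℝ) ^ (2 * s) * Real.sqrt ((2 : ℝ) ^ (3 * k)))⁻¹ *
          ((2 : ℝ) ^ s * (2 : ℝ) ^ s * ∑ u : Fin s → Bool, ∑ c : Fin k → Bool, |W (fun w => signOf (G u w)) c|) :=
        mul_le_mul_of_nonneg_left hS hpos.le
    _ = ((2 : ℝ) ^ s)⁻¹ * ((Real.sqrt ((2 : ℝ) ^ (3 * k)))⁻¹ *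
          ∑ u : Fin s → Bool, ∑ c : Fin k → Bool, |W (fun w => signOf (G u w)) c|) := by
        field_simp
        ring

/-- **Per-slice budget form ("A-level census").** If every slice's `L¹` Walsh mass is at most `B_u` then, against EVERY
partner `f`, `Φ(f,g) ≤ 2^{-s} (Σ_u B_u) / √(2^{3k})`.  With `B_u = 2^{3k/2}` for bent slices and the (strictly smaller)
non-bent maxima for the others this is the rigorous form of the seat's "A-dead" verdicts. [folklore] -/
theorem forrelation_le_of_sliceMass_le {s k : ℕ} (f g : (Fin (s + s + k) → Bool) → Bool)
    (G : (Fin s → Bool) → (Fin k → Bool) → Bool) (π σ : (Fin s → Bool) → (Fin s → Bool))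
    (hσπ : ∀ u, σ (π u) = u) (hπσ : ∀ a, π (σ a) = a)
    (hg : ∀ (y u : Fin s → Bool) (w : Fin k → Bool),
      signOf (g (Fin.append (Fin.append y u) w)) = twist y (π u) * signOf (G u w))
    (B : (Fin s → Bool) → ℝ) (hB : ∀ u, ∑ c : Fin k → Bool, |W (fun w => signOf (G u w)) c| ≤ B u) :
    forrelation f g ≤ ((2 : ℝ) ^ s)⁻¹ * (∑ u : Fin s → Bool, B u) / Real.sqrt ((2 : ℝ) ^ (3 * k)) := by
  refine (forrelation_le_fibreL1 f g G π σ hσπ hπσ hg).trans ?_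
  have hR : (0 : ℝ) ≤ (Real.sqrt ((2 : ℝ) ^ (3 * k)))⁻¹ := by positivity
  calc ((2 : ℝ) ^ s)⁻¹ * ∑ u : Fin s → Bool,
          (Real.sqrt ((2 : ℝ) ^ (3 * k)))⁻¹ * ∑ c : Fin k → Bool, |W (fun w => signOf (G u w)) c|
      ≤ ((2 : ℝ) ^ s)⁻¹ * ∑ u : Fin s → Bool, (Real.sqrt ((2 : ℝ) ^ (3 * k)))⁻¹ * B u :=
        mul_le_mul_of_nonneg_left (sum_le_sum fun u _ => mul_le_mul_of_nonneg_left (hB u) hR) (by positivity)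
    _ = ((2 : ℝ) ^ s)⁻¹ * (∑ u : Fin s → Bool, B u) / Real.sqrt ((2 : ℝ) ^ (3 * k)) := by
        rw [← mul_sum]
        ring

end Summit.QuantumAdvantage.QuantumAdvantage.Theorems.NearExactIsExact.Negative.FibreL1Bound
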